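import Mathlib
import Summits.ResolutionOfSingularities.ResolutionOfSingularities.Theorems.SyzygyFlatteningDefs
import Literature.AlgebraicGeometry.Resolution.AffineDomainDimension
import Literature.AlgebraicGeometry.Resolution.InseparableLocalUniformization
import HarnessLib

/-!
# Every stage of the syzygy-flattening tower has Krull dimension at most `tr.deg_k K`

Crux `SyzygyFlattening.RankOneTermination` (stmt-ResolutionOfSingularities-17044), line `birth`,
registered stub `stub_stageDim` — PROVED: for an affine model `A` of `K/k` (`A.FG`, `Frac A = K`)
and every stage `T = tower O A m` of the tower along a valuation ring `O` of `K`
(`Theorems/SyzygyFlatteningDefs.lean`),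
`ringKrullDim T ≤ n` with `n = syzygyIndex k K = Cardinal.toNat (tr.deg_k K)`.

Proof.  `tr.deg_k K = tr.deg_k A` (`Frac A = K`, tree `trdeg_eq_trdeg_of_isFractionRing`) is a
natural number `n` because `A` is a finitely generated `k`-domain (tree
`exists_ringKrullDim_eq_and_trdeg_eq`, Matsumura Thm. 5.6), so `syzygyIndex k K = n` on the nose
(`Cardinal.toNat_natCast`).  A stage `T` is a `k`-subalgebra of `K`, so
`tr.deg_k T ≤ tr.deg_k K = n` (Mathlib `trdeg_le_of_injective` along `T.val`), and
`dim T ≤ tr.deg_k T` for every domain containing `k` (tree `ringKrullDim_le_of_trdeg_le`: a chain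
of `m + 1` primes yields `m` algebraically independent elements).  The hypotheses `k ⊆ O` and
`A ⊆ O` of the registered signature are not used.
-/

noncomputable section

-- single-problem summit: the doubled namespace component `ResolutionOfSingularities` is forced
set_option linter.dupNamespace false

namespace Summit.ResolutionOfSingularities.ResolutionOfSingularities.Theorems.SyzygyFlattening

open Literature.AlgebraicGeometry.Resolution

section stageDim

variable {k K : Type} [Field k] [Field K] [Algebra k K]

/-- For an affine model `A` of `K/k` (`A` finitely generated, `Frac A = K`) the syzygy index
`syzygyIndex k K = Cardinal.toNat (tr.deg_k K)` IS the transcendence degree: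
`(syzygyIndex k K : Cardinal) = tr.deg_k K` (the latter is the natural number `tr.deg_k A = dim A`).
[cite: Matsumura1987, Thm. 5.6] -/
theorem syzygyIndex_eq_trdeg (A : Subalgebra k K) (hFG : A.FG) (hFrac : IsFractionRing ↥A K) :
    (syzygyIndex k K : Cardinal) = Algebra.trdeg k K := by
  haveI : Algebra.FiniteType k ↥A := (Subalgebra.fg_iff_finiteType A).mp hFG
  haveI := hFrac
  obtain ⟨n, -, htr⟩ := exists_ringKrullDim_eq_and_trdeg_eq k ↥A
  have hK : Algebra.trdeg k K = n := by rw [trdeg_eq_trdeg_of_isFractionRing A, htr]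
  unfold syzygyIndex
  rw [hK, Cardinal.toNat_natCast]

/-- **`dim B ≤ tr.deg_k K`** for every `k`-subalgebra `B` of a field `K` with an affine model
`A` (`A.FG`, `Frac A = K`), the bound written with `syzygyIndex k K = tr.deg_k K ∈ ℕ`:
`tr.deg_k B ≤ tr.deg_k K` along the injection `B ↪ K`, and `dim B ≤ tr.deg_k B` for any domain
over `k`. [cite: Matsumura1987, Thm. 5.6] -/
theorem ringKrullDim_subalgebra_le_syzygyIndex (A : Subalgebra k K) (hFG : A.FG)
    (hFrac : IsFractionRing ↥A K) (B : Subalgebra k K) :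
    ringKrullDim ↥B ≤ (syzygyIndex k K : WithBot ℕ∞) := by
  have hB : Algebra.trdeg k ↥B ≤ (syzygyIndex k K : Cardinal) := by
    rw [syzygyIndex_eq_trdeg A hFG hFrac]
    exact trdeg_le_of_injective B.val Subtype.val_injective
  exact ringKrullDim_le_of_trdeg_le hB

end stageDim

/-- **Registered `stub_stageDim`** (crux stmt-ResolutionOfSingularities-17044, line `birth`):
every stage of the syzygy-flattening tower along `O` started at an affine model `A` of `K/k` has
Krull dimension at most `n = syzygyIndex k K = tr.deg_k K` — a stage is a `k`-subalgebra of `K`,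
`dim ≤ tr.deg` for domains over `k`, and `tr.deg` is monotone along `tower O A m ↪ K`.
[cite: Matsumura1987, Thm. 5.6] -/
theorem stub_stageDim : ∀ (k K : Type) [Field k] [Field K] [Algebra k K]
    (O : ValuationSubring K) (A : Subalgebra k K), (∀ c : k, algebraMap k K c ∈ O) → A.FG →
      IsFractionRing ↥A K → A.toSubring ≤ O.toSubring →
      ∀ m : ℕ, ringKrullDim ↥(tower O A m) ≤ (syzygyIndex k K : WithBot ℕ∞) :=
  fun _ _ _ _ _ O A _ hFG hFrac _ m => ringKrullDim_subalgebra_le_syzygyIndex A hFG hFrac (tower O A m)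

end Summit.ResolutionOfSingularities.ResolutionOfSingularities.Theorems.SyzygyFlattening

end
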